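import Summits.QuantumFields.YangMills.Theorems.ForcedResponseSkewnessRunningCouplingCeilingAxisEndpointMax
import Summits.QuantumFields.YangMills.Theorems.PencilRigidityCurvatureKernelBoundLogConvexExpDecay
import HarnessLib

/-!
# Cruxes `SubCurvatureClause` ⟨stmt-QuantumFields-23763⟩ / `RunningCouplingCeiling` ⟨stmt-QuantumFields-24275⟩ — the reflection-positivity SHAPE of
# both on-axis orders: Hankel positivity (`AxisMirrorShape`, the RP-soft stub of ym-idea-3 g26's IR-wall bridge `crossover-vs-ir.lean` §6, PROVED in
# its letter) and geometric-chord ("spectral") domination on a window of heights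

Helper file (`--supports stmt-QuantumFields-23763 --as helper`; free-hands seat `ym-line-frs-p2` g20; sequel of `…RunningCouplingCeilingAxisEndpointMax`).
Definition-free, 0 sorry, standard axioms.  No item is closed; no summit, no crux and no mass gap is proved by this file.

WHAT.  `lcc(n) = lCC(Q^θ,Q,n)`, `lcc'(n) = lCC(Q,Q^θ,n)` on the odd torus `2L+1` at `β ≥ 0` (the skeleton-local `lcc`/`lcc'`, UNFOLDED).

* `lcc_nonneg_window`: both orders are `≥ 0` at every height `1 ≤ t`, `t + 2 ≤ L`;
* ★ `lcc_chord`: on a window `1 ≤ s₀ < s₁`, `s₁ + 2 ≤ L`, for every `s₀ ≤ s ≤ s₁` with `λ = (s − s₀)/(s₁ − s₀)`: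
  `lcc(2s) ≤ lcc(2s₀)^{1−λ} · lcc(2s₁)^{λ}` and `lcc'(2s) ≤ lcc'(2s₀)^{1−λ} · lcc'(2s₁)^{λ}` (`Real.rpow`; RP log-convexity of both orders —
  ✓`sq_mixedKernel_le_lcc_mul_lcc`, ✓`sq_lcc'_le` — fed to the tree's ✓`CurvatureKernel.LogConvexChordBound`).  This is the finite-volume
  "spectral domination" of the reflected correlator between two heights (`lcc(2s) = ⟪Ω_Q, T^{2s} Ω_Q⟫` without constructing `T`); RP yields SHAPE
  constraints at fixed `β` only — no direction of flow, hence nothing toward `MoebiusRow`;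
* ★ `axisMirrorShape`: the letter of `def AxisMirrorShape` (HOME `ym-idea-3/g26/crossover-vs-ir.lean` :168, the one sorry of g26's bridge
  `crossoverDecayIR_of_IR_stubbed`): for `β ≥ 0`, `1 ≤ L`: `lcc(2t), lcc'(2t) ≥ 0` (`1 ≤ t`, `t + 3 ≤ L`) and the Gram minors
  `lcc(s+t)² ≤ lcc(2s)·lcc(2t)`, `lcc'(s+t)² ≤ lcc'(2s)·lcc'(2t)` (`1 ≤ s,t`, `s + 3, t + 3 ≤ L`).

[cite: OsterwalderSeiler1978, §2]; [cite: FrohlichIsraelLiebSimon1978, Thm. 2.1].  HONEST LABEL: soft lattice lemmas (reflection positivity);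
`MoebiusRow` / `CrossoverDecay` / `IR`, ⟨23763⟩, ⟨24275⟩, ⟨26871⟩ OPEN; the Yang–Mills mass gap is NOT proved; no summit is proved by a line.
-/
set_option autoImplicit false

noncomputable section

open MeasureTheory Filter Topology
open Literature.MathematicalPhysics.QuantumFieldTheory Literature.MathematicalPhysics.QuantumLattice
open Literature.Probability.LatticeModels (Site)
open Summit.QuantumFields.YangMills.Theorems.F4SubCurvatureDoorSubCurvatureClauseMixedAxisDomination (sq_mixedKernel_le_lcc_mul_lcc)
open Summit.QuantumFields.YangMills.Theorems.ForcedResponseSkewnessRunningCouplingCeilingAxisEndpointMax (sq_lcc'_le)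
open Summit.QuantumFields.YangMills.Theorems.CurvatureKernel (LogConvexChordBound)

namespace Summit.QuantumFields.YangMills.Theorems.F4SubCurvatureDoorSubCurvatureClauseAxisMirrorShape

variable {G : Type} [Group G] [TopologicalSpace G] [IsTopologicalGroup G] [CompactSpace G]
  [MeasurableSpace G] [BorelSpace G]

/-- **Both on-axis orders are non-negative** at heights `1 ≤ t`, `t + 2 ≤ L` (`β ≥ 0`). [cite: OsterwalderSeiler1978, §2] -/
theorem lcc_nonneg_window (r : LatticeRep G) {β : ℝ} (hβ : 0 ≤ β) (L t : ℕ) (ht1 : 1 ≤ t) (htL : t + 2 ≤ L) :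
    0 ≤ latticeConnectedCorr r.ρ β (2 * L + 1) r.curvature.timeReflect.F r.curvature.F (2 * t) ∧
    0 ≤ latticeConnectedCorr r.ρ β (2 * L + 1) r.curvature.F r.curvature.timeReflect.F (2 * t) :=
  ⟨(sq_mixedKernel_le_lcc_mul_lcc r hβ L t t htL htL (Pi.single 0 ((t : ℤ) + t)) (by simp)).2.1,
   (sq_lcc'_le r hβ L t t ht1 ht1 (by omega) (by omega)).1⟩

/-- ★ **Geometric-chord domination on a window, both orders.**  For `β ≥ 0`, heights `1 ≤ s₀ < s₁` with `s₁ + 2 ≤ L` and `s₀ ≤ s ≤ s₁`,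
writing `λ = (s − s₀)/(s₁ − s₀)`:  `lcc(2s) ≤ lcc(2s₀)^{1−λ} · lcc(2s₁)^{λ}` and `lcc'(2s) ≤ lcc'(2s₀)^{1−λ} · lcc'(2s₁)^{λ}`.
[cite: OsterwalderSeiler1978, §2] [cite: FrohlichIsraelLiebSimon1978, Thm. 2.1] -/
theorem lcc_chord (r : LatticeRep G) {β : ℝ} (hβ : 0 ≤ β) (L s₀ s₁ : ℕ) (hs₀ : 1 ≤ s₀) (hlt : s₀ < s₁) (hL : s₁ + 2 ≤ L)
    (s : ℕ) (h0s : s₀ ≤ s) (hs1 : s ≤ s₁) :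
    latticeConnectedCorr r.ρ β (2 * L + 1) r.curvature.timeReflect.F r.curvature.F (2 * s) ≤
        latticeConnectedCorr r.ρ β (2 * L + 1) r.curvature.timeReflect.F r.curvature.F (2 * s₀) ^
            (1 - ((s - s₀ : ℕ) : ℝ) / ((s₁ - s₀ : ℕ) : ℝ)) *
          latticeConnectedCorr r.ρ β (2 * L + 1) r.curvature.timeReflect.F r.curvature.F (2 * s₁) ^
            (((s - s₀ : ℕ) : ℝ) / ((s₁ - s₀ : ℕ) : ℝ)) ∧
      latticeConnectedCorr r.ρ β (2 * L + 1) r.curvature.F r.curvature.timeReflect.F (2 * s) ≤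
        latticeConnectedCorr r.ρ β (2 * L + 1) r.curvature.F r.curvature.timeReflect.F (2 * s₀) ^
            (1 - ((s - s₀ : ℕ) : ℝ) / ((s₁ - s₀ : ℕ) : ℝ)) *
          latticeConnectedCorr r.ρ β (2 * L + 1) r.curvature.F r.curvature.timeReflect.F (2 * s₁) ^
            (((s - s₀ : ℕ) : ℝ) / ((s₁ - s₀ : ℕ) : ℝ)) := by
  set U : ℕ := s₁ - s₀ with hU_def
  have hU : 0 < U := by omega
  have hsU : s - s₀ ≤ U := by omega
  have es : s₀ + (s - s₀) = s := by omega
  have eU : s₀ + U = s₁ := by omega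
  constructor
  · set E : ℕ → ℝ := fun u => latticeConnectedCorr r.ρ β (2 * L + 1) r.curvature.timeReflect.F r.curvature.F (2 * (s₀ + u))
      with hE
    have hnn : ∀ u, u ≤ U → 0 ≤ E u := fun u hu =>
      (sq_mixedKernel_le_lcc_mul_lcc r hβ L (s₀ + u) (s₀ + u) (by omega) (by omega)
        (Pi.single 0 (((s₀ + u : ℕ) : ℤ) + ((s₀ + u : ℕ) : ℤ))) (by simp)).2.1
    have hlc : ∀ u, 0 < u → u < U → E u ^ 2 ≤ E (u - 1) * E (u + 1) := by
      intro u hu0 huU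
      have h := (sq_mixedKernel_le_lcc_mul_lcc r hβ L (s₀ + u + 1) (s₀ + u - 1) (by omega) (by omega)
        (Pi.single 0 ((2 * (s₀ + u) : ℕ) : ℤ)) (by simp; omega)).2.2
      rw [← Summit.QuantumFields.YangMills.Theorems.F4SubCurvatureDoorSubCurvatureClauseMixedAxisDomination.lcc_eq_mixedKernel] at h
      have e1 : s₀ + (u - 1) = s₀ + u - 1 := by omega
      have e2 : s₀ + (u + 1) = s₀ + u + 1 := by omega
      simp only [hE, e1, e2]
      exact h
    have key := LogConvexChordBound E U hU hnn hlc (s - s₀) hsU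
    simp only [hE, es, eU, Nat.add_zero] at key
    exact key
  · set E : ℕ → ℝ := fun u => latticeConnectedCorr r.ρ β (2 * L + 1) r.curvature.F r.curvature.timeReflect.F (2 * (s₀ + u))
      with hE
    have hnn : ∀ u, u ≤ U → 0 ≤ E u := fun u hu =>
      (sq_lcc'_le r hβ L (s₀ + u) (s₀ + u) (by omega) (by omega) (by omega) (by omega)).1
    have hlc : ∀ u, 0 < u → u < U → E u ^ 2 ≤ E (u - 1) * E (u + 1) := by
      intro u hu0 huU
      have h := (sq_lcc'_le r hβ L (s₀ + u - 1) (s₀ + u + 1) (by omega) (by omega) (by omega) (by omega)).2.2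
      have e0 : s₀ + u - 1 + (s₀ + u + 1) = 2 * (s₀ + u) := by omega
      have e1 : s₀ + (u - 1) = s₀ + u - 1 := by omega
      have e2 : s₀ + (u + 1) = s₀ + u + 1 := by omega
      rw [e0] at h
      simp only [hE, e1, e2]
      exact h
    have key := LogConvexChordBound E U hU hnn hlc (s - s₀) hsU
    simp only [hE, es, eU, Nat.add_zero] at key
    exact key

/-- ★ **`AxisMirrorShape`** (the RP-soft stub `stub_axisMirrorShape` of ym-idea-3 g26's bridge `crossover-vs-ir.lean`, in its letter with `lcc`/`lcc'`
unfolded): both mirror orders of the curvature pair are Hankel-positive on the odd torus — non-negativity at even lags and the Gram/Cauchy–Schwarz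
minors for lags inside the positive half. [cite: OsterwalderSeiler1978, §2] [cite: FrohlichIsraelLiebSimon1978, Thm. 2.1] -/
theorem axisMirrorShape : ∀ (G : Type) [Group G] [TopologicalSpace G] [IsTopologicalGroup G] [CompactSpace G],
    IsCompactSimpleLieGroup G →
    letI : MeasurableSpace G := borel G
    haveI : BorelSpace G := ⟨rfl⟩
    ∀ (r : LatticeRep G) (β : ℝ) (L : ℕ), 0 ≤ β → 1 ≤ L →
      (∀ t : ℕ, 1 ≤ t → t + 3 ≤ L →
        0 ≤ latticeConnectedCorr r.ρ β (2 * L + 1) r.curvature.timeReflect.F r.curvature.F (2 * t) ∧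
        0 ≤ latticeConnectedCorr r.ρ β (2 * L + 1) r.curvature.F r.curvature.timeReflect.F (2 * t)) ∧
      (∀ s t : ℕ, 1 ≤ s → 1 ≤ t → s + 3 ≤ L → t + 3 ≤ L →
        latticeConnectedCorr r.ρ β (2 * L + 1) r.curvature.timeReflect.F r.curvature.F (s + t) ^ 2 ≤
          latticeConnectedCorr r.ρ β (2 * L + 1) r.curvature.timeReflect.F r.curvature.F (2 * s) *
            latticeConnectedCorr r.ρ β (2 * L + 1) r.curvature.timeReflect.F r.curvature.F (2 * t) ∧
        latticeConnectedCorr r.ρ β (2 * L + 1) r.curvature.F r.curvature.timeReflect.F (s + t) ^ 2 ≤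
          latticeConnectedCorr r.ρ β (2 * L + 1) r.curvature.F r.curvature.timeReflect.F (2 * s) *
            latticeConnectedCorr r.ρ β (2 * L + 1) r.curvature.F r.curvature.timeReflect.F (2 * t)) := by
  intro G _ _ _ _ _hG
  letI : MeasurableSpace G := borel G
  haveI : BorelSpace G := ⟨rfl⟩
  intro r β L hβ _hL
  refine ⟨fun t ht1 ht3 => lcc_nonneg_window r hβ L t ht1 (by omega), fun s t hs1 ht1 hs3 ht3 => ⟨?_, ?_⟩⟩
  · have h := (sq_mixedKernel_le_lcc_mul_lcc r hβ L t s (by omega) (by omega)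
      (Pi.single 0 ((s + t : ℕ) : ℤ)) (by simp; omega)).2.2
    rw [← Summit.QuantumFields.YangMills.Theorems.F4SubCurvatureDoorSubCurvatureClauseMixedAxisDomination.lcc_eq_mixedKernel] at h
    exact h
  · exact (sq_lcc'_le r hβ L s t hs1 ht1 (by omega) (by omega)).2.2

end Summit.QuantumFields.YangMills.Theorems.F4SubCurvatureDoorSubCurvatureClauseAxisMirrorShape

end
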